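import Summits.HubbardSuperconductivity.HubbardSuperconductivity.Theorems.NoGoNogoSingletPairKillsSaturatedFM
import Literature.MathematicalPhysics.QuantumLattice.HubbardHubbardModelEtaODLROProofs
import Literature.MathematicalPhysics.QuantumLattice.HubbardHubbardModelEtaPairingProofs
import Literature.MathematicalPhysics.QuantumLattice.FermionOperatorsProofs
import HarnessLib

/-!
# Crux `MesoscopicPairOrder` (item `stmt-HubbardSuperconductivity-7331`), line `SketchIdeator4`:
# the exact η-dressing identity for the crux's pair correlators (card item (C2))

For an `η`-annihilated `(N+2)`-particle vector `ψ` on the fermionic torus `(ℤ/Lℤ)²` and all sites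
`x, y`:

  `(L² - N) · ⟨P_x ψ, P_y ψ⟩ = ⟨η† P_x ψ, η† P_y ψ⟩`,

`P_x = localPair g L x` (any form factor `g`), `η = etaLower torusStagger`, `η† = etaRaise torusStagger`.
So on η-lowest-weight states (every sector ground state in the η-corner, tree
`eta_annihilates_groundStates_in_corner`) the pair correlator of the crux equals `(L² - N)⁻¹ ×` the
correlator of the NUMBER-CONSERVING composite `η† P_x` — Wigner–Eckart bookkeeping for the pseudospin
triplet containing the `d`-wave pair field (Zhang 1990), recorded for certificate design (it moves the
order parameter into the charge-neutral sector); it is an identity, not an inequality.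

* `annihilation_pair_mul_pair_comm` — bilinears in annihilators commute (CAR);
* `etaLower_commute_localPair` — `[η, P_x] = 0`;
* `star_etaRaise_mulVec_dotProduct_etaRaise_mulVec` — polarised Yang identity
  `⟨η†u, η†v⟩ = ⟨ηu, ηv⟩ + (|Λ| - N)⟨u, v⟩` for an `N`-particle `v`;
* `etaDressedPairIdentity` — the identity above.

No definition is introduced. Yang, PRL 63 (1989) 2144, eq. (6); S.-C. Zhang, PRL 65 (1990) 120;
Yang–Zhang, Mod. Phys. Lett. B 4 (1990) 759. Folklore computation.
-/

noncomputable section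

-- the summit namespace repeats the problem name by design (D-0017)
set_option linter.dupNamespace false

namespace Summit.HubbardSuperconductivity.HubbardSuperconductivity.Theorems.FunctionFieldCertificate

open Matrix Finset
open Literature.Probability.LatticeModels Literature.MathematicalPhysics.QuantumLattice
open scoped ComplexOrder

/-- **Bilinears in annihilation operators commute**: `(c_a c_b)(c_c c_d) = (c_c c_d)(c_a c_b)`
(four sign flips from `{c_i, c_j} = 0`). Bratteli–Robinson II §5.2.2. [folklore] -/
theorem annihilation_pair_mul_pair_comm {ι : Type*} [LinearOrder ι] [Fintype ι] (a b c d : ι) :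
    annihilation a * annihilation b * (annihilation c * annihilation d) =
      annihilation c * annihilation d * (annihilation a * annihilation b : Matrix _ _ ℂ) := by
  have h : ∀ i j : ι, annihilation i * annihilation j = -(annihilation j * annihilation i : Matrix _ _ ℂ) :=
    fun i j => eq_neg_of_add_eq_zero_left (annihilation_anticommute_holds i j)
  set A : Matrix (Finset ι) (Finset ι) ℂ := annihilation a
  set B : Matrix (Finset ι) (Finset ι) ℂ := annihilation b
  set C : Matrix (Finset ι) (Finset ι) ℂ := annihilation c
  set D : Matrix (Finset ι) (Finset ι) ℂ := annihilation d
  have hbc : B * C = -(C * B) := h b c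
  have hbd : B * D = -(D * B) := h b d
  have hac : A * C = -(C * A) := h a c
  have had : A * D = -(D * A) := h a d
  calc A * B * (C * D) = A * (B * C) * D := by noncomm_ring
    _ = -(A * C) * (B * D) := by rw [hbc]; noncomm_ring
    _ = -(-(C * A)) * (-(D * B)) := by rw [hac, hbd]
    _ = -(C * (A * D) * B) := by noncomm_ring
    _ = C * D * (A * B) := by rw [had]; noncomm_ring

/-- **`[η, P_x] = 0`**: Yang's `η = Σ_z ε_z c_{z↓} c_{z↑}` commutes with every local pair operator
`P_x = Σ_e (g(e)/√2)(c_{x↑} c_{x+e,↓} - c_{x↓} c_{x+e,↑})` — both are bilinears in annihilators.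
Zhang, PRL 65 (1990) 120. [folklore] -/
theorem etaLower_commute_localPair (L : ℕ) [NeZero L] (ε : FermionTorus 2 L → ℤˣ) (g : Site 2 → ℝ)
    (x : TorusSite 2 L) : Commute (etaLower ε) (localPair g L x) := by
  rw [etaLower_eq_sum_holds, localPair]
  refine Commute.sum_left _ _ _ fun z _ => Commute.sum_right _ _ _ fun e _ => ?_
  refine Commute.smul_left (Commute.smul_right (Commute.sub_right ?_ ?_) _) _
  · exact annihilation_pair_mul_pair_comm _ _ _ _
  · exact annihilation_pair_mul_pair_comm _ _ _ _

/-- **Polarised Yang identity**: for any signs `ε`, any `u` and any `N`-particle `v`,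
`⟨η†u, η†v⟩ = ⟨ηu, ηv⟩ + (|Λ| - N)⟨u, v⟩` (from `η η† = η† η + (|Λ| - N̂)`, tree
`EtaPairingODLRO.etaLower_mulVec_etaRaise_mulVec`). Yang, PRL 63 (1989) 2144, eq. (6). [folklore] -/
theorem star_etaRaise_mulVec_dotProduct_etaRaise_mulVec {Λ : Type*} [LinearOrder Λ] [Fintype Λ]
    (ε : Λ → ℤˣ) {N : ℕ} (u v : Fock (Orb Λ)) (hv : IsNParticle N v) :
    star (etaRaise ε *ᵥ u) ⬝ᵥ (etaRaise ε *ᵥ v) =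
      star (etaLower ε *ᵥ u) ⬝ᵥ (etaLower ε *ᵥ v) + ((Fintype.card Λ : ℂ) - N) * (star u ⬝ᵥ v) := by
  have hdef : (etaRaise ε)ᴴ = etaLower ε := rfl
  have h1 : star (etaRaise ε *ᵥ u) ⬝ᵥ (etaRaise ε *ᵥ v) =
      star u ⬝ᵥ (etaLower ε *ᵥ (etaRaise ε *ᵥ v)) := by
    rw [star_mulVec, ← dotProduct_mulVec, hdef]
  have h2 : star (etaLower ε *ᵥ u) ⬝ᵥ (etaLower ε *ᵥ v) =
      star u ⬝ᵥ (etaRaise ε *ᵥ (etaLower ε *ᵥ v)) := by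
    rw [star_mulVec, ← dotProduct_mulVec, ← hdef, conjTranspose_conjTranspose]
  have h3 : star u ⬝ᵥ (fun s => ((Fintype.card Λ : ℂ) - s.card) * v s) =
      ((Fintype.card Λ : ℂ) - N) * (star u ⬝ᵥ v) := by
    rw [dotProduct, dotProduct, Finset.mul_sum]
    refine Finset.sum_congr rfl fun s _ => ?_
    by_cases hs : s.card = N
    · rw [Pi.star_apply, hs]
      ring
    · rw [Pi.star_apply, hv s hs]
      simp
  rw [h1, EtaPairingODLRO.etaLower_mulVec_etaRaise_mulVec, dotProduct_add, h2, h3]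

/-- **The η-dressing identity for the crux's pair correlators** (card `eta-lowest-weight-annihilators`,
item (C2)). For every side `L`, every `N`, every form factor `g` and every `(N+2)`-particle vector `ψ`
with `η ψ = 0` (`η = etaLower torusStagger`), and all sites `x, y`:
`(L² - N) ⟨P_x ψ, P_y ψ⟩ = ⟨η† P_x ψ, η† P_y ψ⟩` (`P_x = localPair g L x`, `η† = etaRaise torusStagger`).
Proof: `P_y ψ` is an `N`-particle vector, `η P_x ψ = P_x η ψ = 0` (`[η, P_x] = 0`), and the polarised
Yang identity. Zhang, PRL 65 (1990) 120; Yang, PRL 63 (1989) 2144, eq. (6). [folklore] -/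
theorem etaDressedPairIdentity : ∀ (L N : ℕ) [NeZero L] (g : Site 2 → ℝ)
    (ψ : Fock (Orb (FermionTorus 2 L))), IsNParticle (N + 2) ψ →
      etaLower (torusStagger : FermionTorus 2 L → ℤˣ) *ᵥ ψ = 0 → ∀ x y : TorusSite 2 L,
        ((L : ℂ) ^ 2 - (N : ℂ)) * (star (localPair g L x *ᵥ ψ) ⬝ᵥ (localPair g L y *ᵥ ψ)) =
          star (etaRaise torusStagger *ᵥ (localPair g L x *ᵥ ψ)) ⬝ᵥ
            (etaRaise torusStagger *ᵥ (localPair g L y *ᵥ ψ)) := by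
  intro L N _ g ψ hN hη x y
  have hv : IsNParticle N (localPair g L y *ᵥ ψ) := by
    have h := Summit.HubbardSuperconductivity.NoGo.isNParticle_localPair_mulVec g L y hN
    rwa [show N + 2 - 2 = N by omega] at h
  have hkill : ∀ z : TorusSite 2 L,
      etaLower (torusStagger : FermionTorus 2 L → ℤˣ) *ᵥ (localPair g L z *ᵥ ψ) = 0 := by
    intro z
    rw [mulVec_mulVec, (etaLower_commute_localPair L torusStagger g z).eq, ← mulVec_mulVec, hη,
      mulVec_zero]
  rw [star_etaRaise_mulVec_dotProduct_etaRaise_mulVec torusStagger _ _ hv, hkill x, hkill y,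
    card_fermionTorus]
  simp

end Summit.HubbardSuperconductivity.HubbardSuperconductivity.Theorems.FunctionFieldCertificate
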